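import Summits.BirchSwinnertonDyer.Rank1Residual.Additive.RamifiedSevenPrimitiveAdmissibleMemberUpToUnit
import HarnessLib

set_option autoImplicit false

/-!
# `𝒞₇` genus road (crux `EllipticUnitValueSevenOfGZK`, K7r): the REALISATION-THREADED letters (x1) — crux K2ᶜ's three
# ∀-letters `hIC` / «K2cPinned» / `hK2c` re-typed with the binder `(hR : ∃ z₀ : I.H, IsAdmissibleZetaClass W 7 K hK I z₀) →`
# right after the pin `I`, and the six assemblies re-threaded; THEOREMS ONLY, next to the old ones (nothing deleted)

Cell bsd-cm, seat bsd-cm-k-ty1 g34 (literature-prover, HANDS; pen WORD D1113, spec D1111 (x1) «REALISATION-THREADED LETTERS»,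
critic idea-crit-15 g17 NOTE #15 = AUDIT-W2).  Imports `RamifiedSevenPrimitiveAdmissibleMemberUpToUnit` (hence (P1)
`RamifiedSevenGenusKatoPinnedFrame`, (P3) `RamifiedSevenResidueIsGenusUnitClassOfIntegralComparison`, (B3)
`RamifiedSevenResidualNonvanishingOfGenus`, (B4)).  No `def`, no named fact, no instance, no notation, no `sorry`; kit 0.

## Why (AUDIT-W2, D1111 FINDING (W2); numbers, not adjectives)

The registered research stubs (S-D) `stub_katoExpPadicDatumSeven` and (S-★) `stub_periodPositionSeven` of zp v19 are typed
`∀ (W, K, hK, γ, hγ, I)`.  Their ★-pin `zOne_pos : ZetaClassPosition W 7 K hK I k zOne` is a ∀ over REALISED value-pinned families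
in `I.H` (`Kato2004.HasRealisedZetaFamilyBody`, data (A0)–(A4), (A5′), (A6′)), which the tree can instantiate today ONLY at the
realised member (conjunct 10 + hR3c ⇒ `HasMuFreeRealisedZetaFamily W″ …`; the Literature realisability facts are guarded by
`HasIrreducibleModPGaloisRep` / `¬ CMRamified`, both failing on `𝒞₇` at `7`).  At a non-realised `(W, I)` the stubs are therefore
statements about an UNCONSTRAINED `hSC.choose` — not provable AS TYPED there — while the assembly consumes them only where an
admissible class is ALREADY in hand: (B3)'s `residualNonvanishingSeven_of_genus` introduces `z₀ hz₀` BEFORE invoking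
`hK2c W hC K hK γ hγ I` (`RamifiedSevenResidualNonvanishingOfGenus.lean` :165–183).  The repair of record (x1): insert the binder
`(hR : ∃ z₀ : I.H, Kato2004.IsAdmissibleZetaClass W 7 K hK I z₀) →` right after `(I : IwasawaH1Data W 7 K γ)` in the three
∀-letters — `hIC` of `k2cPinned_of_integralComparison` ((P3) :237), «K2cPinned» (= the `hK2cP` binder of `hK2c_of_k2cPinned`,
(P1) :340) and `hK2c` of `residualNonvanishingSeven_of_genus` ((B3) :165) — and re-thread the six assemblies with the SAME
conclusions: `k2cPinnedR_of_integralComparisonR`, `hK2cR_of_k2cPinnedR` (proofs = the old ones with `hR` passed along),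
`residualNonvanishingSeven_of_genusR` (one token: `hK2cR W hC K hK γ hγ I ⟨z₀, hz₀⟩`),
`primitiveAdmissibleMemberSeven_of_residueR` / `_of_unitGenusR` / ★ `primitiveAdmissibleMemberSeven_of_integralComparisonR_upToUnit`
(the SAME conclusion as today's ★ `primitiveAdmissibleMemberSeven_of_integralComparison_upToUnit`).  Two convenience re-threadings
of (P1)/(P3)'s RNV7 corollaries are added (`residualNonvanishingSeven_of_k2cPinnedR`, `…_of_integralComparisonR`).

## The three R-letters (the `hICR` TYPE in full — it becomes zp's `integralComparisonSevenR_of` letter at touch (9))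

* `hICR` :≡ `exists_zetaClassPosition_of_rank_le_one → rank_eq_analyticRank_of_analyticRank_le_one →
    ∀ (W : WeierstrassCurve ℚ) [W.IsElliptic] [W.IsGloballyMinimal] [Fact (Nat.Prime 7)], X12.ClassCSeven W →
    letI : ContinuousSMul ℤ_[7] (W.tateModule 7) := TateModule.continuousSMul_padicInt
    ∀ (K : ZpExtension ℚ 7) (hK : K.IsCyclotomic) (γ : Field.absoluteGaloisGroup ℚ) (_ : K.IsTopGenerator γ)
      (I : IwasawaH1Data W 7 K γ), (∃ z₀ : I.H, Kato2004.IsAdmissibleZetaClass W 7 K hK I z₀) →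
      ∃ (F : GenusFrame) (θu : ∀ n : ℕ, globalUnitsOf (F.layer n)), IsNormedEllipticUnitFamily F θu ∧
        ∀ d : GenusDatum F θu, ∃ Φ : PinnedKatoGenusFrame W K hK I d, IntegralComparisonShape Φ`;
* «K2cPinnedR» :≡ the same with `ResidueIsGenusUnitClassShape Φ.toKatoGenusFrame` for `IntegralComparisonShape Φ`;
* `hK2cR` :≡ `∀ W … I, (∃ z₀, IsAdmissibleZetaClass W 7 K hK I z₀) → ∃ (F, θu) value-pinned, ∀ d, ∃ Φ : KatoGenusFrame W K hK I d,
  ResidueIsGenusUnitClassShape Φ` (no ★/GZK antecedents, as (B3)'s `hK2c`).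

HONEST LABEL: re-typings and conditional assemblies (kernel); nothing is asserted to exist; no stub is registered or touched by
this file (the skeleton side is the pen's touch (9)); nothing about Kato's values, Conj. 12.10, `X12.CMRamifiedSeven` or BSD is
proved; stmt-BirchSwinnertonDyer-19945 is OPEN; no summit statement is proved by this seat; BSD is claimed for no curve.

References: K. Kato, Astérisque 295 (2004) Thm. 12.5 (1)(4) (pp. 221–222), Conj. 12.10 (p. 224), 15.14 (p. 264), (15.16.1)
(p. 265) [Kato2004Asterisque]; T. Tsuji, J. Number Theory 78 (1999) Thm 3.1 (i) [Tsuji1999]; B. Ferrero, L. Washington, Ann. of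
Math. 109 (1979) [FerreroWashington1979]; cell records STATUS D1108 (R7), D1111 (x1), D1113; critic NOTE #15 (AUDIT-W2).
-/

noncomputable section

open scoped Classical NumberField
open WeierstrassCurve Literature.NumberTheory.EllipticCurves
open Literature.NumberTheory.EllipticCurves.Rank1Residual
open Literature.NumberTheory.EllipticCurves.IwasawaAlgebra
open Literature.NumberTheory.EllipticCurves.Kato2004
open Literature.NumberTheory.ComplexMultiplication.EllipticUnits
open Summit.BirchSwinnertonDyer.Rank1Residual
open Summit.BirchSwinnertonDyer.Rank1Residual.Additive

namespace Summit.BirchSwinnertonDyer.Rank1Residual.Additive.GenusSeven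

/-! ## §1 `hICR` ⇒ «K2cPinnedR» ⇒ `hK2cR` -/

/-- **«K2cPinnedR» FROM THE REALISATION-THREADED PINNED INTEGRAL COMPARISON `hICR`** (definitional re-reading through
`integralComparisonShape_iff`, as (P3)'s `k2cPinned_of_integralComparison`, with the binder
`(∃ z₀ : I.H, IsAdmissibleZetaClass W 7 K hK I z₀) →` threaded after `I`).  CONDITIONAL; nothing asserted.
[cite: Kato2004Asterisque, §15.16 (15.16.1) (p. 265)] -/
theorem k2cPinnedR_of_integralComparisonR
    (hICR : exists_zetaClassPosition_of_rank_le_one → rank_eq_analyticRank_of_analyticRank_le_one →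
      ∀ (W : WeierstrassCurve ℚ) [W.IsElliptic] [W.IsGloballyMinimal] [Fact (Nat.Prime 7)], X12.ClassCSeven W →
      letI : ContinuousSMul ℤ_[7] (W.tateModule 7) := TateModule.continuousSMul_padicInt
      ∀ (K : ZpExtension ℚ 7) (hK : K.IsCyclotomic) (γ : Field.absoluteGaloisGroup ℚ) (_ : K.IsTopGenerator γ)
        (I : IwasawaH1Data W 7 K γ), (∃ z₀ : I.H, Kato2004.IsAdmissibleZetaClass W 7 K hK I z₀) →
        ∃ (F : GenusFrame) (θu : ∀ n : ℕ, globalUnitsOf (F.layer n)), IsNormedEllipticUnitFamily F θu ∧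
          ∀ d : GenusDatum F θu, ∃ Φ : PinnedKatoGenusFrame W K hK I d, IntegralComparisonShape Φ) :
    exists_zetaClassPosition_of_rank_le_one → rank_eq_analyticRank_of_analyticRank_le_one →
      ∀ (W : WeierstrassCurve ℚ) [W.IsElliptic] [W.IsGloballyMinimal] [Fact (Nat.Prime 7)], X12.ClassCSeven W →
      letI : ContinuousSMul ℤ_[7] (W.tateModule 7) := TateModule.continuousSMul_padicInt
      ∀ (K : ZpExtension ℚ 7) (hK : K.IsCyclotomic) (γ : Field.absoluteGaloisGroup ℚ) (_ : K.IsTopGenerator γ)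
        (I : IwasawaH1Data W 7 K γ), (∃ z₀ : I.H, Kato2004.IsAdmissibleZetaClass W 7 K hK I z₀) →
        ∃ (F : GenusFrame) (θu : ∀ n : ℕ, globalUnitsOf (F.layer n)), IsNormedEllipticUnitFamily F θu ∧
          ∀ d : GenusDatum F θu, ∃ Φ : PinnedKatoGenusFrame W K hK I d,
            ResidueIsGenusUnitClassShape Φ.toKatoGenusFrame :=
  hICR

/-- **`hK2cR` (the realisation-threaded form of (B3)'s `hK2c` letter) FROM «K2cPinnedR»**, ★ and GZK — (P1)'s
`hK2c_of_k2cPinned` with `hR` passed along (projection `residueIsGenusUnitClass_of_pinned`).  CONDITIONAL; nothing asserted.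
[cite: Kato2004Asterisque, (15.16.1) (p. 265), Prop. 15.9 (p. 258), Thm. 12.5 (1) (p. 221)] -/
theorem hK2cR_of_k2cPinnedR (hstar : exists_zetaClassPosition_of_rank_le_one)
    (hGZK : rank_eq_analyticRank_of_analyticRank_le_one)
    (hK2cPR : exists_zetaClassPosition_of_rank_le_one → rank_eq_analyticRank_of_analyticRank_le_one →
      ∀ (W : WeierstrassCurve ℚ) [W.IsElliptic] [W.IsGloballyMinimal] [Fact (Nat.Prime 7)], X12.ClassCSeven W →
      letI : ContinuousSMul ℤ_[7] (W.tateModule 7) := TateModule.continuousSMul_padicInt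
      ∀ (K : ZpExtension ℚ 7) (hK : K.IsCyclotomic) (γ : Field.absoluteGaloisGroup ℚ) (_ : K.IsTopGenerator γ)
        (I : IwasawaH1Data W 7 K γ), (∃ z₀ : I.H, Kato2004.IsAdmissibleZetaClass W 7 K hK I z₀) →
        ∃ (F : GenusFrame) (θu : ∀ n : ℕ, globalUnitsOf (F.layer n)), IsNormedEllipticUnitFamily F θu ∧
          ∀ d : GenusDatum F θu, ∃ Φ : PinnedKatoGenusFrame W K hK I d,
            ResidueIsGenusUnitClassShape Φ.toKatoGenusFrame) :
    ∀ (W : WeierstrassCurve ℚ) [W.IsElliptic] [W.IsGloballyMinimal] [Fact (Nat.Prime 7)], X12.ClassCSeven W →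
      letI : ContinuousSMul ℤ_[7] (W.tateModule 7) := TateModule.continuousSMul_padicInt
      ∀ (K : ZpExtension ℚ 7) (hK : K.IsCyclotomic) (γ : Field.absoluteGaloisGroup ℚ) (_ : K.IsTopGenerator γ)
        (I : IwasawaH1Data W 7 K γ), (∃ z₀ : I.H, Kato2004.IsAdmissibleZetaClass W 7 K hK I z₀) →
        ∃ (F : GenusFrame) (θu : ∀ n : ℕ, globalUnitsOf (F.layer n)), IsNormedEllipticUnitFamily F θu ∧
          ∀ d : GenusDatum F θu, ∃ Φ : KatoGenusFrame W K hK I d, ResidueIsGenusUnitClassShape Φ := by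
  intro W _ _ _ hC K hK γ hγ I hR
  haveI : ContinuousSMul ℤ_[7] (W.tateModule 7) := TateModule.continuousSMul_padicInt
  obtain ⟨F, θu, hpin, hΦ⟩ := hK2cPR hstar hGZK W hC K hK γ hγ I hR
  exact ⟨F, θu, hpin, fun d => residueIsGenusUnitClass_of_pinned (hΦ d)⟩

/-! ## §2 RNV7 from the realisation-threaded K2ᶜ letter -/

/-- **RESIDUAL NON-VANISHING ON `𝒞₇` (RNV7, conclusion VERBATIM that of (B3)'s `residualNonvanishingSeven_of_genus`) FROM THE
GENUS RESIDUE AND THE REALISATION-THREADED K2ᶜ LETTER `hK2cR`.**  Proof = (B3)'s, with the admissible class in hand fed to the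
threaded binder: `hK2cR W hC K hK γ hγ I ⟨z₀, hz₀⟩` — the one-token difference that D1111 (x1) records (the assembly consumes
K2ᶜ only where an admissible class is ALREADY in hand).  CONDITIONAL; nothing asserted; 19945 stays OPEN.
[cite: Kato2004Asterisque, (15.16.1) (p. 265), Thm. 12.5 (1) (p. 221), Conj. 12.10 (p. 224)] [cite: Tsuji1999, Thm 3.1 (i) (p. 6)]
[cite: FerreroWashington1979, main theorem] -/
theorem residualNonvanishingSeven_of_genusR
    (hRes : ∀ (F : GenusFrame) (θu : ∀ n : ℕ, globalUnitsOf (F.layer n)), IsNormedEllipticUnitFamily F θu →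
      ∃ d : GenusDatum F θu, GenusResidueNonzeroShape d)
    (hK2cR : ∀ (W : WeierstrassCurve ℚ) [W.IsElliptic] [W.IsGloballyMinimal] [Fact (Nat.Prime 7)], X12.ClassCSeven W →
      letI : ContinuousSMul ℤ_[7] (W.tateModule 7) := TateModule.continuousSMul_padicInt
      ∀ (K : ZpExtension ℚ 7) (hK : K.IsCyclotomic) (γ : Field.absoluteGaloisGroup ℚ) (_ : K.IsTopGenerator γ)
        (I : IwasawaH1Data W 7 K γ), (∃ z₀ : I.H, Kato2004.IsAdmissibleZetaClass W 7 K hK I z₀) →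
        ∃ (F : GenusFrame) (θu : ∀ n : ℕ, globalUnitsOf (F.layer n)), IsNormedEllipticUnitFamily F θu ∧
          ∀ d : GenusDatum F θu, ∃ Φ : KatoGenusFrame W K hK I d, ResidueIsGenusUnitClassShape Φ) :
    ∀ (W : WeierstrassCurve ℚ) [W.IsElliptic] [W.IsGloballyMinimal] [Fact (Nat.Prime 7)], X12.ClassCSeven W →
      letI : ContinuousSMul ℤ_[7] (W.tateModule 7) := TateModule.continuousSMul_padicInt
      ∀ (K : ZpExtension ℚ 7) (hK : K.IsCyclotomic) (γ : Field.absoluteGaloisGroup ℚ) (_ : K.IsTopGenerator γ)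
        (I : IwasawaH1Data W 7 K γ) (z₀ : I.H), Kato2004.IsAdmissibleZetaClass W 7 K hK I z₀ →
        z₀ ∉ (IwasawaAlgebra.augIdealP 7 • (⊤ : Submodule (IwasawaAlgebra 7) I.H)) := by
  intro W _ _ _ hC K hK γ hγ I z₀ hz₀
  haveI : ContinuousSMul ℤ_[7] (W.tateModule 7) := TateModule.continuousSMul_padicInt
  obtain ⟨F, θu, hpin, hΦ⟩ := hK2cR W hC K hK γ hγ I ⟨z₀, hz₀⟩
  obtain ⟨d, hres⟩ := hRes F θu hpin
  obtain ⟨Φ, hshape⟩ := hΦ d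
  exact Φ.not_mem_augIdealP_smul_top hγ hshape hres hz₀

/-- RNV7 from «K2cPinnedR», the genus residue, ★ and GZK ((P1)'s `residualNonvanishingSeven_of_k2cPinned`, re-threaded).
CONDITIONAL; nothing asserted; 19945 OPEN. [cite: Kato2004Asterisque, (15.16.1) (p. 265), Thm. 12.5 (1) (p. 221), Conj. 12.10 (p. 224)] -/
theorem residualNonvanishingSeven_of_k2cPinnedR (hstar : exists_zetaClassPosition_of_rank_le_one)
    (hGZK : rank_eq_analyticRank_of_analyticRank_le_one)
    (hRes : ∀ (F : GenusFrame) (θu : ∀ n : ℕ, globalUnitsOf (F.layer n)), IsNormedEllipticUnitFamily F θu →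
      ∃ d : GenusDatum F θu, GenusResidueNonzeroShape d)
    (hK2cPR : exists_zetaClassPosition_of_rank_le_one → rank_eq_analyticRank_of_analyticRank_le_one →
      ∀ (W : WeierstrassCurve ℚ) [W.IsElliptic] [W.IsGloballyMinimal] [Fact (Nat.Prime 7)], X12.ClassCSeven W →
      letI : ContinuousSMul ℤ_[7] (W.tateModule 7) := TateModule.continuousSMul_padicInt
      ∀ (K : ZpExtension ℚ 7) (hK : K.IsCyclotomic) (γ : Field.absoluteGaloisGroup ℚ) (_ : K.IsTopGenerator γ)
        (I : IwasawaH1Data W 7 K γ), (∃ z₀ : I.H, Kato2004.IsAdmissibleZetaClass W 7 K hK I z₀) →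
        ∃ (F : GenusFrame) (θu : ∀ n : ℕ, globalUnitsOf (F.layer n)), IsNormedEllipticUnitFamily F θu ∧
          ∀ d : GenusDatum F θu, ∃ Φ : PinnedKatoGenusFrame W K hK I d,
            ResidueIsGenusUnitClassShape Φ.toKatoGenusFrame) :
    ∀ (W : WeierstrassCurve ℚ) [W.IsElliptic] [W.IsGloballyMinimal] [Fact (Nat.Prime 7)], X12.ClassCSeven W →
      letI : ContinuousSMul ℤ_[7] (W.tateModule 7) := TateModule.continuousSMul_padicInt
      ∀ (K : ZpExtension ℚ 7) (hK : K.IsCyclotomic) (γ : Field.absoluteGaloisGroup ℚ) (_ : K.IsTopGenerator γ)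
        (I : IwasawaH1Data W 7 K γ) (z₀ : I.H), Kato2004.IsAdmissibleZetaClass W 7 K hK I z₀ →
        z₀ ∉ (IwasawaAlgebra.augIdealP 7 • (⊤ : Submodule (IwasawaAlgebra 7) I.H)) :=
  residualNonvanishingSeven_of_genusR hRes (hK2cR_of_k2cPinnedR hstar hGZK hK2cPR)

/-- RNV7 from the realisation-threaded pinned integral comparison `hICR`, the genus residue, ★ and GZK ((P3)'s
`residualNonvanishingSeven_of_integralComparison`, re-threaded). CONDITIONAL; nothing asserted; 19945 OPEN.
[cite: Kato2004Asterisque, (15.16.1) (p. 265), Thm. 12.5 (1) (p. 221), Conj. 12.10 (p. 224)] -/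
theorem residualNonvanishingSeven_of_integralComparisonR (hstar : exists_zetaClassPosition_of_rank_le_one)
    (hGZK : rank_eq_analyticRank_of_analyticRank_le_one)
    (hRes : ∀ (F : GenusFrame) (θu : ∀ n : ℕ, globalUnitsOf (F.layer n)), IsNormedEllipticUnitFamily F θu →
      ∃ d : GenusDatum F θu, GenusResidueNonzeroShape d)
    (hICR : exists_zetaClassPosition_of_rank_le_one → rank_eq_analyticRank_of_analyticRank_le_one →
      ∀ (W : WeierstrassCurve ℚ) [W.IsElliptic] [W.IsGloballyMinimal] [Fact (Nat.Prime 7)], X12.ClassCSeven W →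
      letI : ContinuousSMul ℤ_[7] (W.tateModule 7) := TateModule.continuousSMul_padicInt
      ∀ (K : ZpExtension ℚ 7) (hK : K.IsCyclotomic) (γ : Field.absoluteGaloisGroup ℚ) (_ : K.IsTopGenerator γ)
        (I : IwasawaH1Data W 7 K γ), (∃ z₀ : I.H, Kato2004.IsAdmissibleZetaClass W 7 K hK I z₀) →
        ∃ (F : GenusFrame) (θu : ∀ n : ℕ, globalUnitsOf (F.layer n)), IsNormedEllipticUnitFamily F θu ∧
          ∀ d : GenusDatum F θu, ∃ Φ : PinnedKatoGenusFrame W K hK I d, IntegralComparisonShape Φ) :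
    ∀ (W : WeierstrassCurve ℚ) [W.IsElliptic] [W.IsGloballyMinimal] [Fact (Nat.Prime 7)], X12.ClassCSeven W →
      letI : ContinuousSMul ℤ_[7] (W.tateModule 7) := TateModule.continuousSMul_padicInt
      ∀ (K : ZpExtension ℚ 7) (hK : K.IsCyclotomic) (γ : Field.absoluteGaloisGroup ℚ) (_ : K.IsTopGenerator γ)
        (I : IwasawaH1Data W 7 K γ) (z₀ : I.H), Kato2004.IsAdmissibleZetaClass W 7 K hK I z₀ →
        z₀ ∉ (IwasawaAlgebra.augIdealP 7 • (⊤ : Submodule (IwasawaAlgebra 7) I.H)) :=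
  residualNonvanishingSeven_of_k2cPinnedR hstar hGZK hRes (k2cPinnedR_of_integralComparisonR hICR)

/-! ## §3 Stub 2★ (type VERBATIM) from the realisation-threaded letters -/

/-- **STUB 2★ (zp `stub_primitiveAdmissibleMemberSeven` TYPE, VERBATIM) from the genus inputs with K1ᵘ in the RESIDUE form
`hRes`, K2ᶜ in the REALISATION-THREADED form `hK2cR`, and (E2)** — (B4)/UpToUnit's `primitiveAdmissibleMemberSeven_of_residue`
with conjunct (ii) by `residualNonvanishingSeven_of_genusR hRes hK2cR`; conjunct (i) unchanged (★ + GZK + (E2)'s realised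
`μ`-free family at the isogenous member `W′`).  CONDITIONAL; nothing asserted; 19945 OPEN.
[cite: Kato2004Asterisque, Thm. 12.5 (1)(4) (pp. 221–222), Conj. 12.10 (p. 224), (15.16.1) (p. 265)] [cite: Tsuji1999, Thm 3.1 (i) (p. 6)] -/
theorem primitiveAdmissibleMemberSeven_of_residueR (hstar : exists_zetaClassPosition_of_rank_le_one)
    (hGZK : rank_eq_analyticRank_of_analyticRank_le_one)
    (hRes : ∀ (F : GenusFrame) (θu : ∀ n : ℕ, globalUnitsOf (F.layer n)), IsNormedEllipticUnitFamily F θu →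
      ∃ d : GenusDatum F θu, GenusResidueNonzeroShape d)
    (hK2cR : ∀ (W : WeierstrassCurve ℚ) [W.IsElliptic] [W.IsGloballyMinimal] [Fact (Nat.Prime 7)], X12.ClassCSeven W →
      letI : ContinuousSMul ℤ_[7] (W.tateModule 7) := TateModule.continuousSMul_padicInt
      ∀ (K : ZpExtension ℚ 7) (hK : K.IsCyclotomic) (γ : Field.absoluteGaloisGroup ℚ) (_ : K.IsTopGenerator γ)
        (I : IwasawaH1Data W 7 K γ), (∃ z₀ : I.H, Kato2004.IsAdmissibleZetaClass W 7 K hK I z₀) →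
        ∃ (F : GenusFrame) (θu : ∀ n : ℕ, globalUnitsOf (F.layer n)), IsNormedEllipticUnitFamily F θu ∧
          ∀ d : GenusDatum F θu, ∃ Φ : KatoGenusFrame W K hK I d, ResidueIsGenusUnitClassShape Φ)
    (hE2 : ∀ (W : WeierstrassCurve ℚ) [W.IsElliptic] [W.IsGloballyMinimal] [Fact (Nat.Prime 7)], X12.ClassCSeven W →
      ∃ (W' : WeierstrassCurve ℚ) (_ : W'.IsElliptic) (_ : W'.IsGloballyMinimal), IsIsogenous W W' ∧
        letI : ContinuousSMul ℤ_[7] (W'.tateModule 7) := TateModule.continuousSMul_padicInt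
        ∀ (K : ZpExtension ℚ 7) (hK : K.IsCyclotomic) (γ : Field.absoluteGaloisGroup ℚ) (_ : K.IsTopGenerator γ)
          (I : IwasawaH1Data W' 7 K γ), Kato2004.HasMuFreeRealisedZetaFamily W' 7 K hK I) :
    ∀ (W : WeierstrassCurve ℚ) [W.IsElliptic] [W.IsGloballyMinimal] [Fact (Nat.Prime 7)], X12.ClassCSeven W →
      ∃ (W' : WeierstrassCurve ℚ) (_ : W'.IsElliptic) (_ : W'.IsGloballyMinimal), IsIsogenous W W' ∧
        letI : ContinuousSMul ℤ_[7] (W'.tateModule 7) := TateModule.continuousSMul_padicInt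
        (∃ (K : ZpExtension ℚ 7) (hK : K.IsCyclotomic) (γ : Field.absoluteGaloisGroup ℚ) (_ : K.IsTopGenerator γ)
          (I : IwasawaH1Data W' 7 K γ) (z₀ : I.H), Kato2004.IsAdmissibleZetaClass W' 7 K hK I z₀) ∧
        (∀ (K : ZpExtension ℚ 7) (hK : K.IsCyclotomic) (γ : Field.absoluteGaloisGroup ℚ) (_ : K.IsTopGenerator γ)
          (I : IwasawaH1Data W' 7 K γ) (z₀ : I.H), Kato2004.IsAdmissibleZetaClass W' 7 K hK I z₀ →
          z₀ ∉ (IwasawaAlgebra.augIdealP 7 • (⊤ : Submodule (IwasawaAlgebra 7) I.H))) := by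
  intro W _ _ _ hC
  obtain ⟨W', hE', hM', hiso, hfam⟩ := hE2 W hC
  haveI := hE'
  haveI := hM'
  have hC' : X12.ClassCSeven W' := hC.of_isIsogenous hiso
  refine ⟨W', hE', hM', hiso, ?_, residualNonvanishingSeven_of_genusR hRes hK2cR W' hC'⟩
  haveI : ContinuousSMul ℤ_[7] (W'.tateModule 7) := TateModule.continuousSMul_padicInt
  have hK : (CyclotomicZp.zpExtension 7).IsCyclotomic := CyclotomicZp.isCyclotomic_zpExtension 7
  obtain ⟨γ, hγ, -⟩ := CyclotomicZp.exists_isTopGenerator_zpExtension 7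
  obtain ⟨I⟩ := nonempty_iwasawaH1Data_holds W' 7 (CyclotomicZp.zpExtension 7) γ hK hγ
  obtain ⟨z₀, hz₀⟩ :=
    exists_isAdmissibleZetaClass_of_classCSeven hstar hGZK W' hC' hK hγ I (hfam _ hK γ hγ I)
  exact ⟨CyclotomicZp.zpExtension 7, hK, γ, hγ, I, z₀, hz₀⟩

/-- **STUB 2★ (type VERBATIM) from the genus inputs with K1ᵘ in the UNIT form and K2ᶜ in the REALISATION-THREADED form `hK2cR`**
(§3 at `hRes := exists_genusResidueNonzero_of_unitK1u h₄ h₂ h₂' hK1u`).  CONDITIONAL; nothing asserted; 19945 OPEN.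
[cite: Kato2004Asterisque, Thm. 12.5 (1)(4) (pp. 221–222), (15.16.1) (p. 265)] [cite: Tsuji1999, Thm 3.1 (i) (p. 6)] [cite: FerreroWashington1979, main theorem] -/
theorem primitiveAdmissibleMemberSeven_of_unitGenusR (hstar : exists_zetaClassPosition_of_rank_le_one)
    (hGZK : rank_eq_analyticRank_of_analyticRank_le_one)
    (h₄ : Literature.NumberTheory.IwasawaTheory.tsuji1999_thm31_colemanMap)
    (h₂ : Literature.NumberTheory.IwasawaTheory.ferreroWashington_kubotaLeopoldtSeries_unitCoeff)
    (h₂' : Literature.NumberTheory.IwasawaTheory.ferreroWashington_stickelbergerSeries_unitCoeff)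
    (hK1u : ∀ (F : GenusFrame) (θu : ∀ n : ℕ, globalUnitsOf (F.layer n)), IsNormedEllipticUnitFamily F θu →
      ∃ d : OrientedGenusDatum F θu, d.UnitFactorisationShape)
    (hK2cR : ∀ (W : WeierstrassCurve ℚ) [W.IsElliptic] [W.IsGloballyMinimal] [Fact (Nat.Prime 7)], X12.ClassCSeven W →
      letI : ContinuousSMul ℤ_[7] (W.tateModule 7) := TateModule.continuousSMul_padicInt
      ∀ (K : ZpExtension ℚ 7) (hK : K.IsCyclotomic) (γ : Field.absoluteGaloisGroup ℚ) (_ : K.IsTopGenerator γ)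
        (I : IwasawaH1Data W 7 K γ), (∃ z₀ : I.H, Kato2004.IsAdmissibleZetaClass W 7 K hK I z₀) →
        ∃ (F : GenusFrame) (θu : ∀ n : ℕ, globalUnitsOf (F.layer n)), IsNormedEllipticUnitFamily F θu ∧
          ∀ d : GenusDatum F θu, ∃ Φ : KatoGenusFrame W K hK I d, ResidueIsGenusUnitClassShape Φ)
    (hE2 : ∀ (W : WeierstrassCurve ℚ) [W.IsElliptic] [W.IsGloballyMinimal] [Fact (Nat.Prime 7)], X12.ClassCSeven W →
      ∃ (W' : WeierstrassCurve ℚ) (_ : W'.IsElliptic) (_ : W'.IsGloballyMinimal), IsIsogenous W W' ∧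
        letI : ContinuousSMul ℤ_[7] (W'.tateModule 7) := TateModule.continuousSMul_padicInt
        ∀ (K : ZpExtension ℚ 7) (hK : K.IsCyclotomic) (γ : Field.absoluteGaloisGroup ℚ) (_ : K.IsTopGenerator γ)
          (I : IwasawaH1Data W' 7 K γ), Kato2004.HasMuFreeRealisedZetaFamily W' 7 K hK I) :
    ∀ (W : WeierstrassCurve ℚ) [W.IsElliptic] [W.IsGloballyMinimal] [Fact (Nat.Prime 7)], X12.ClassCSeven W →
      ∃ (W' : WeierstrassCurve ℚ) (_ : W'.IsElliptic) (_ : W'.IsGloballyMinimal), IsIsogenous W W' ∧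
        letI : ContinuousSMul ℤ_[7] (W'.tateModule 7) := TateModule.continuousSMul_padicInt
        (∃ (K : ZpExtension ℚ 7) (hK : K.IsCyclotomic) (γ : Field.absoluteGaloisGroup ℚ) (_ : K.IsTopGenerator γ)
          (I : IwasawaH1Data W' 7 K γ) (z₀ : I.H), Kato2004.IsAdmissibleZetaClass W' 7 K hK I z₀) ∧
        (∀ (K : ZpExtension ℚ 7) (hK : K.IsCyclotomic) (γ : Field.absoluteGaloisGroup ℚ) (_ : K.IsTopGenerator γ)
          (I : IwasawaH1Data W' 7 K γ) (z₀ : I.H), Kato2004.IsAdmissibleZetaClass W' 7 K hK I z₀ →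
          z₀ ∉ (IwasawaAlgebra.augIdealP 7 • (⊤ : Submodule (IwasawaAlgebra 7) I.H))) :=
  primitiveAdmissibleMemberSeven_of_residueR hstar hGZK (exists_genusResidueNonzero_of_unitK1u h₄ h₂ h₂' hK1u) hK2cR hE2

/-- ★ **STUB 2★ (type VERBATIM) from the genus inputs with K1ᵘ in the UNIT form and K2ᶜ in its REALISATION-THREADED PINNED
INTEGRAL-COMPARISON form `hICR`** — the SAME conclusion as today's ★ `primitiveAdmissibleMemberSeven_of_integralComparison_upToUnit`;
the term a touch-(9) composition closes by `exact … fact_star hGZK fact_tsuji fact_fwKL fact_fwSt genusUnitFactorisationSeven_of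
integralComparisonSevenR_of stub_muFreeRealisedFamilySeven`.  CONDITIONAL; nothing asserted; 19945 OPEN.
[cite: Kato2004Asterisque, Thm. 12.5 (1)(4) (pp. 221–222), 15.14 (p. 264), (15.16.1) (p. 265)] [cite: Tsuji1999, Thm 3.1 (i) (p. 6)] -/
theorem primitiveAdmissibleMemberSeven_of_integralComparisonR_upToUnit (hstar : exists_zetaClassPosition_of_rank_le_one)
    (hGZK : rank_eq_analyticRank_of_analyticRank_le_one)
    (h₄ : Literature.NumberTheory.IwasawaTheory.tsuji1999_thm31_colemanMap)
    (h₂ : Literature.NumberTheory.IwasawaTheory.ferreroWashington_kubotaLeopoldtSeries_unitCoeff)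
    (h₂' : Literature.NumberTheory.IwasawaTheory.ferreroWashington_stickelbergerSeries_unitCoeff)
    (hK1u : ∀ (F : GenusFrame) (θu : ∀ n : ℕ, globalUnitsOf (F.layer n)), IsNormedEllipticUnitFamily F θu →
      ∃ d : OrientedGenusDatum F θu, d.UnitFactorisationShape)
    (hICR : exists_zetaClassPosition_of_rank_le_one → rank_eq_analyticRank_of_analyticRank_le_one →
      ∀ (W : WeierstrassCurve ℚ) [W.IsElliptic] [W.IsGloballyMinimal] [Fact (Nat.Prime 7)], X12.ClassCSeven W →
      letI : ContinuousSMul ℤ_[7] (W.tateModule 7) := TateModule.continuousSMul_padicInt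
      ∀ (K : ZpExtension ℚ 7) (hK : K.IsCyclotomic) (γ : Field.absoluteGaloisGroup ℚ) (_ : K.IsTopGenerator γ)
        (I : IwasawaH1Data W 7 K γ), (∃ z₀ : I.H, Kato2004.IsAdmissibleZetaClass W 7 K hK I z₀) →
        ∃ (F : GenusFrame) (θu : ∀ n : ℕ, globalUnitsOf (F.layer n)), IsNormedEllipticUnitFamily F θu ∧
          ∀ d : GenusDatum F θu, ∃ Φ : PinnedKatoGenusFrame W K hK I d, IntegralComparisonShape Φ)
    (hE2 : ∀ (W : WeierstrassCurve ℚ) [W.IsElliptic] [W.IsGloballyMinimal] [Fact (Nat.Prime 7)], X12.ClassCSeven W →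
      ∃ (W' : WeierstrassCurve ℚ) (_ : W'.IsElliptic) (_ : W'.IsGloballyMinimal), WeierstrassCurve.IsIsogenous W W' ∧
        letI : ContinuousSMul ℤ_[7] (W'.tateModule 7) := TateModule.continuousSMul_padicInt
        ∀ (K : ZpExtension ℚ 7) (hK : K.IsCyclotomic) (γ : Field.absoluteGaloisGroup ℚ) (_ : K.IsTopGenerator γ)
          (I : IwasawaH1Data W' 7 K γ), Kato2004.HasMuFreeRealisedZetaFamily W' 7 K hK I) :
    ∀ (W : WeierstrassCurve ℚ) [W.IsElliptic] [W.IsGloballyMinimal] [Fact (Nat.Prime 7)], X12.ClassCSeven W →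
      ∃ (W' : WeierstrassCurve ℚ) (_ : W'.IsElliptic) (_ : W'.IsGloballyMinimal), WeierstrassCurve.IsIsogenous W W' ∧
        letI : ContinuousSMul ℤ_[7] (W'.tateModule 7) := TateModule.continuousSMul_padicInt
        (∃ (K : ZpExtension ℚ 7) (hK : K.IsCyclotomic) (γ : Field.absoluteGaloisGroup ℚ) (_ : K.IsTopGenerator γ)
          (I : IwasawaH1Data W' 7 K γ) (z₀ : I.H), Kato2004.IsAdmissibleZetaClass W' 7 K hK I z₀) ∧
        (∀ (K : ZpExtension ℚ 7) (hK : K.IsCyclotomic) (γ : Field.absoluteGaloisGroup ℚ) (_ : K.IsTopGenerator γ)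
          (I : IwasawaH1Data W' 7 K γ) (z₀ : I.H), Kato2004.IsAdmissibleZetaClass W' 7 K hK I z₀ →
          z₀ ∉ (IwasawaAlgebra.augIdealP 7 • (⊤ : Submodule (IwasawaAlgebra 7) I.H))) :=
  primitiveAdmissibleMemberSeven_of_unitGenusR hstar hGZK h₄ h₂ h₂' hK1u
    (hK2cR_of_k2cPinnedR hstar hGZK (k2cPinnedR_of_integralComparisonR hICR)) hE2

end Summit.BirchSwinnertonDyer.Rank1Residual.Additive.GenusSeven

end
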